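import Summits.CriticalPhenomena.PercolationContinuityZ3.Theorems.PercNearOneGluingNoHeavyQuantFarGate3Assembly
import HarnessLib

/-!
# QUANT lane R8, front "FAR beyond trees", layer one — THE DEGREE-THREE GATE AT THE OBSERVER, XIV: the crowd regime

builds on p205010 (kernel theorem, internal audit signed; external expert review pending)

Support file (`--supports stmt-CriticalPhenomena-4575`), seat `prim-quant-p1` (gen 28); memo
`run/shared/lean/prim/quant/prim-quant-p1-g28/FOR-LEAD-GATE3.md` §6c.  Standard axioms; no sorries; no definitions.

**The crowd regime** (item `A(1/n)` of the menu, memo §5: outside cuts alone).  With `n = |A ∖ {v,u₁,u₂}|` relays besides the gate,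
the outside cuts give `n(1−t) ≤ S = Σ_b P(o ↔ b)`, the mean bound of file X gives `S ≤ Σ_c sub_c·x_c`, and CELLWISE `sub_c ≤ n·φ_c`
as soon as `n·p(1 − max r) ≥ 1 − p·max r` and `n·p(1−r₁)(1−r₂) ≥ 1 − p(1 − (1−r₁)(1−r₂))` (the `k = 1` cells of the apart types; all
other cells unconditionally); hence `1 − t ≤ Σ φ·x = P(N ≥ 2)`, i.e. the row, with no mean hypothesis and no Harris.
`Gate3.arith_crowd` is the pure-real statement in the format of the cover lemma; `Quant.farLayerOne_of_gate3_crowd` the row.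
Together with the tame gate (file VI) this leaves the general gate open only for FEW relays at small `p`, `r` (memo §7).
[cite: KozmaNitzan2024, Conjecture 3 (p. 15)]; [cite: Grimmett1999, §1.3 p. 10, §2.2]; [this work].
-/

noncomputable section

namespace Summit.CriticalPhenomena.PercolationContinuityZ3.Theorems

namespace Quant

open Finset MeasureTheory Set
open Literature.Probability.LatticeModels
open Literature.Probability.Percolation
open Bundle (offZ)
open scoped Classical

namespace Gate3

/-- **Crowd certificate** (pure real, cover-lemma format without the mean line): many relays ⟹ `Σ(1−φ)x ≤ t`. [this work] -/
theorem arith_crowd (p r₁ r₂ nn : ℝ) (hp0 : 0 ≤ p) (hp1 : p ≤ 1) (hr10 : 0 ≤ r₁) (hr11 : r₁ ≤ 1) (hr20 : 0 ≤ r₂) (hr21 : r₂ ≤ 1)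
    (hn : 1 ≤ nn) (hn1 : 1 - p * max r₁ r₂ ≤ nn * (p * (1 - max r₁ r₂)))
    (hn3 : 1 - p * (1 - (1 - r₁) * (1 - r₂)) ≤ nn * (p * ((1 - r₁) * (1 - r₂))))
    (t S a0 a1 a2 b10 b11 b12 b20 b21 b22 c0 c1 c2 d0 d1 d2 : ℝ)
    (hna0 : 0 ≤ a0)
    (hna1 : 0 ≤ a1)
    (hna2 : 0 ≤ a2)
    (hnb10 : 0 ≤ b10)
    (hnb11 : 0 ≤ b11)
    (hnb12 : 0 ≤ b12)
    (hnb20 : 0 ≤ b20)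
    (hnb21 : 0 ≤ b21)
    (hnb22 : 0 ≤ b22)
    (hnc0 : 0 ≤ c0)
    (hnc1 : 0 ≤ c1)
    (hnc2 : 0 ≤ c2)
    (hnd0 : 0 ≤ d0)
    (hnd1 : 0 ≤ d1)
    (hnd2 : 0 ≤ d2)
    (hsum : a0 + a1 + a2 + b10 + b11 + b12 + b20 + b21 + b22 + c0 + c1 + c2 + d0 + d1 + d2 = 1)
    (_hH1 : ((a0 + a1 + a2) + (c0 + c1 + c2) + (b20 + b21 + b22)) * ((a0 + a1 + a2) + (b10 + b11 + b12)) ≤ (a0 + a1 + a2))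
    (_hH2 : ((a0 + a1 + a2) + (c0 + c1 + c2) + (b10 + b11 + b12)) * ((a0 + a1 + a2) + (b20 + b21 + b22)) ≤ (a0 + a1 + a2))
    (_hH3 : ((a0 + a1 + a2) + (b10 + b11 + b12) + (b20 + b21 + b22)) * ((a0 + a1 + a2) + (c0 + c1 + c2)) ≤ (a0 + a1 + a2))
    (_hcv : (1 - p) * (r₁ * r₂) * ((a0 + a1 + a2) + (c0 + c1 + c2)) + (1 - p) * (r₁ * (1 - r₂)) * ((a0 + a1 + a2) + (c0 + c1 + c2) + (b20 + b21 + b22)) + (1 - p) * ((1 - r₁) * r₂) * ((a0 + a1 + a2) + (c0 + c1 + c2) + (b10 + b11 + b12)) + (1 - p) * ((1 - r₁) * (1 - r₂)) ≤ t)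
    (_hc1 : p * ((1 - r₁) * r₂) * ((a0 + a1 + a2) + (b20 + b21 + b22)) + (1 - p) * (r₁ * r₂) * ((a0 + a1 + a2) + (c0 + c1 + c2)) + (p * ((1 - r₁) * (1 - r₂)) + (1 - p) * (r₁ * (1 - r₂)) + (1 - p) * ((1 - r₁) * r₂) + (1 - p) * ((1 - r₁) * (1 - r₂))) * ((a0 + a1 + a2) + (c0 + c1 + c2) + (b20 + b21 + b22)) ≤ t)
    (_hc2 : p * ((1 - r₂) * r₁) * ((a0 + a1 + a2) + (b10 + b11 + b12)) + (1 - p) * (r₂ * r₁) * ((a0 + a1 + a2) + (c0 + c1 + c2)) + (p * ((1 - r₂) * (1 - r₁)) + (1 - p) * (r₂ * (1 - r₁)) + (1 - p) * ((1 - r₂) * r₁) + (1 - p) * ((1 - r₂) * (1 - r₁))) * ((a0 + a1 + a2) + (c0 + c1 + c2) + (b10 + b11 + b12)) ≤ t)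
    (hout : nn - S ≤ nn * t)
    (hsub : S ≤ (p * max r₁ r₂ * nn * a0 + (1 + p * max r₁ r₂ * (nn - 1)) * a1 + nn * a2) + ((1 - (1 - p) * (1 - r₁)) * r₂ * nn * b10 + (1 + (1 - (1 - p) * (1 - r₁)) * r₂ * (nn - 1)) * b11 + nn * b12) + ((1 - (1 - p) * (1 - r₂)) * r₁ * nn * b20 + (1 + (1 - (1 - p) * (1 - r₂)) * r₁ * (nn - 1)) * b21 + nn * b22) + (p * (1 - (1 - r₁) * (1 - r₂)) * nn * c0 + (1 + p * (1 - (1 - r₁) * (1 - r₂)) * (nn - 1)) * c1 + nn * c2) + ((1 : ℝ) * d1 + nn * d2)) :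
    p * ((1 - r₁) * (1 - r₂)) * (a0 + c0) + (1 - p) * (r₁ * r₂) * (a0 + a1 + c0 + c1) + (1 - p) * (r₁ * (1 - r₂)) * (a0 + a1 + c0 + c1 + b20) + (1 - p) * ((1 - r₁) * r₂) * (a0 + a1 + c0 + c1 + b10) + (1 - p) * ((1 - r₁) * (1 - r₂)) * (a0 + a1 + c0 + c1 + b10 + b20) ≤ t := by
  have hn0 : 0 ≤ nn := by linarith only [hn]
  have h1W1 : 0 ≤ 1 - (1 - p) * (1 - r₁) := by
    have h := mul_nonneg hp0 (sub_nonneg.2 hr11)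
    linarith only [h, hr10]
  have h1W2 : 0 ≤ 1 - (1 - p) * (1 - r₂) := by
    have h := mul_nonneg hp0 (sub_nonneg.2 hr21)
    linarith only [h, hr20]
  have hW1le : 1 - (1 - p) * (1 - r₁) ≤ 1 := by
    have h := mul_nonneg (sub_nonneg.2 hp1) (sub_nonneg.2 hr11)
    linarith only [h]
  have hW2le : 1 - (1 - p) * (1 - r₂) ≤ 1 := by
    have h := mul_nonneg (sub_nonneg.2 hp1) (sub_nonneg.2 hr21)
    linarith only [h]
  have hf1 : (1 - (1 - p) * (1 - r₁)) * r₂ ≤ 1 := by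
    have h := mul_le_mul hW1le hr21 hr20 zero_le_one
    linarith only [h]
  have hf2 : (1 - (1 - p) * (1 - r₂)) * r₁ ≤ 1 := by
    have h := mul_le_mul hW2le hr11 hr10 zero_le_one
    linarith only [h]
  have ka0 : p * max r₁ r₂ * nn ≤ nn * (p * (1 - (1 - r₁) * (1 - r₂))) := by
    have hm1 : r₁ ≤ 1 - (1 - r₁) * (1 - r₂) := by
      have h := mul_nonneg hr20 (sub_nonneg.2 hr11)
      linarith only [h]
    have hm2 : r₂ ≤ 1 - (1 - r₁) * (1 - r₂) := by
      have h := mul_nonneg hr10 (sub_nonneg.2 hr21)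
      linarith only [h]
    have h := mul_le_mul_of_nonneg_left (max_le hm1 hm2) (mul_nonneg hn0 hp0)
    linarith only [h]
  have ka1 : (1 + p * max r₁ r₂ * (nn - 1)) ≤ nn * p := by linarith only [hn1]
  have ka2 : nn ≤ nn * 1 := le_of_eq (mul_one nn).symm
  have kb10 : (1 - (1 - p) * (1 - r₁)) * r₂ * nn ≤ nn * (1 - (1 - p) * (1 - r₁)) := by
    have h := mul_nonneg hn0 (mul_nonneg h1W1 (sub_nonneg.2 hr21))
    linarith only [h]
  have kb11 : (1 + (1 - (1 - p) * (1 - r₁)) * r₂ * (nn - 1)) ≤ nn * 1 := by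
    have h := mul_nonneg (sub_nonneg.2 hn) (sub_nonneg.2 hf1)
    linarith only [h]
  have kb12 : nn ≤ nn * 1 := le_of_eq (mul_one nn).symm
  have kb20 : (1 - (1 - p) * (1 - r₂)) * r₁ * nn ≤ nn * (1 - (1 - p) * (1 - r₂)) := by
    have h := mul_nonneg hn0 (mul_nonneg h1W2 (sub_nonneg.2 hr11))
    linarith only [h]
  have kb21 : (1 + (1 - (1 - p) * (1 - r₂)) * r₁ * (nn - 1)) ≤ nn * 1 := by
    have h := mul_nonneg (sub_nonneg.2 hn) (sub_nonneg.2 hf2)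
    linarith only [h]
  have kb22 : nn ≤ nn * 1 := le_of_eq (mul_one nn).symm
  have kc0 : p * (1 - (1 - r₁) * (1 - r₂)) * nn ≤ nn * (p * (1 - (1 - r₁) * (1 - r₂))) := le_of_eq (by ring)
  have kc1 : (1 + p * (1 - (1 - r₁) * (1 - r₂)) * (nn - 1)) ≤ nn * p := by linarith only [hn3]
  have kc2 : nn ≤ nn * 1 := le_of_eq (mul_one nn).symm
  have kd1 : (1 : ℝ) ≤ nn * 1 := by linarith only [hn]
  have kd2 : nn ≤ nn * 1 := le_of_eq (mul_one nn).symm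
  have ma0 := mul_le_mul_of_nonneg_right ka0 hna0
  have ma1 := mul_le_mul_of_nonneg_right ka1 hna1
  have ma2 := mul_le_mul_of_nonneg_right ka2 hna2
  have mb10 := mul_le_mul_of_nonneg_right kb10 hnb10
  have mb11 := mul_le_mul_of_nonneg_right kb11 hnb11
  have mb12 := mul_le_mul_of_nonneg_right kb12 hnb12
  have mb20 := mul_le_mul_of_nonneg_right kb20 hnb20
  have mb21 := mul_le_mul_of_nonneg_right kb21 hnb21
  have mb22 := mul_le_mul_of_nonneg_right kb22 hnb22
  have mc0 := mul_le_mul_of_nonneg_right kc0 hnc0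
  have mc1 := mul_le_mul_of_nonneg_right kc1 hnc1
  have mc2 := mul_le_mul_of_nonneg_right kc2 hnc2
  have md1 := mul_le_mul_of_nonneg_right kd1 hnd1
  have md2 := mul_le_mul_of_nonneg_right kd2 hnd2
  have md0 : 0 ≤ nn * d0 := mul_nonneg hn0 hnd0
  have hsn : nn * (a0 + a1 + a2 + b10 + b11 + b12 + b20 + b21 + b22 + c0 + c1 + c2 + d0 + d1 + d2) = nn := by rw [hsum, mul_one]
  have hfin : nn * (p * ((1 - r₁) * (1 - r₂)) * (a0 + c0) + (1 - p) * (r₁ * r₂) * (a0 + a1 + c0 + c1) + (1 - p) * (r₁ * (1 - r₂)) * (a0 + a1 + c0 + c1 + b20) + (1 - p) * ((1 - r₁) * r₂) * (a0 + a1 + c0 + c1 + b10) + (1 - p) * ((1 - r₁) * (1 - r₂)) * (a0 + a1 + c0 + c1 + b10 + b20)) ≤ nn * t := by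
    linarith only [ma0, ma1, ma2, mb10, mb11, mb12, mb20, mb21, mb22, mc0, mc1, mc2, md1, md2, hout, hsub, hsn, md0]
  exact le_of_mul_le_mul_left hfin (by linarith only [hn])

end Gate3

variable {n : ℕ}

/-- **FAR at layer one for the degree-three gate in the CROWD regime**: if `A` holds `n ≥ 1` relays besides `v, u₁, u₂` with
`n·p(1 − max(r₁,r₂)) ≥ 1 − p·max(r₁,r₂)` and `n·p(1−r₁)(1−r₂) ≥ 1 − p(1−(1−r₁)(1−r₂))`, the cuts alone give the row (no mean, any graph). [this work] -/
theorem farLayerOne_of_gate3_crowd (w : Sym2 (Fin n) → unitInterval) (A : Finset (Fin n)) {o v u₁ u₂ : Fin n}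
    (hov : o ≠ v) (h1v : u₁ ≠ v) (h2v : u₂ ≠ v) (ho1 : o ≠ u₁) (ho2 : o ≠ u₂) (h12 : u₁ ≠ u₂)
    (hvA : v ∈ A) (h1A : u₁ ∈ A) (h2A : u₂ ∈ A)
    (hw : ∀ z : Fin n, z ≠ o → z ≠ u₁ → z ≠ u₂ → z ≠ v → (w s(v, z) : ℝ) = 0)
    (hn : 1 ≤ ((((A.erase v).erase u₁).erase u₂).card : ℝ))
    (hn1 : 1 - (w s(o, v) : ℝ) * max (w s(v, u₁) : ℝ) (w s(v, u₂) : ℝ) ≤ ((((A.erase v).erase u₁).erase u₂).card : ℝ) * ((w s(o, v) : ℝ) * (1 - max (w s(v, u₁) : ℝ) (w s(v, u₂) : ℝ))))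
    (hn3 : 1 - (w s(o, v) : ℝ) * (1 - (1 - (w s(v, u₁) : ℝ)) * (1 - (w s(v, u₂) : ℝ))) ≤ ((((A.erase v).erase u₁).erase u₂).card : ℝ) * ((w s(o, v) : ℝ) * ((1 - (w s(v, u₁) : ℝ)) * (1 - (w s(v, u₂) : ℝ)))))
    (t : ℝ) (hcut : ∀ a ∈ A, (prodBernoulli w).real (openConn o a : Set (BondConfig (Fin n)))ᶜ ≤ t) :
    (prodBernoulli w).real {ω : BondConfig (Fin n) | (A.filter fun a => ω ∈ openConn o a).card ≤ 1} ≤ t :=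
  farLayerOne_of_gate3_of_cover_nomean w A hov h1v h2v ho1 ho2 h12 hvA h1A h2A hw
    (Gate3.arith_crowd (w s(o, v) : ℝ) (w s(v, u₁) : ℝ) (w s(v, u₂) : ℝ) ((((A.erase v).erase u₁).erase u₂).card : ℝ) (w s(o, v)).2.1 (w s(o, v)).2.2 (w s(v, u₁)).2.1 (w s(v, u₁)).2.2 (w s(v, u₂)).2.1 (w s(v, u₂)).2.2
      hn hn1 hn3) t hcut

end Quant

end Summit.CriticalPhenomena.PercolationContinuityZ3.Theorems
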